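import Summits.ResolutionOfSingularities.ResolutionOfSingularities.Theorems.FrobeniusLadderFInjectiveMacaulayficationProp44Invariants
import Literature.AlgebraicGeometry.Resolution.BlowupReducedDimension
import HarnessLib

/-!
# [CoP1] Prop. 4.4 (`CossartPiltant2008_prop44`, F-71): the DIMENSION BOUND persists along every sequence of permissible
# blowing-ups of the W4.6 currency, and along the Cossart–Piltant stages (the `hX3` rider of the patching-route stubs)

[L1 W4.5a · crux `FInjectiveMacaulayfication` (stmt-ResolutionOfSingularities-15315); D-0154 (2) RES inputs cell, seat res-inputs-p-9c g2
(F-71 patching-route hygiene, referee res-inputs-crit-1 R29/R33: the REACH / curve stubs of the assembly skeleton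
`plan/inputs/candidates/F71_ASSEMBLY_W46_SKELETON_p8b.lean` need a dimension pin `topologicalKrullDim X ≤ 3` on the stage — the piece
kinds «threefold point», «curve» presuppose it — and this file supplies it at their call sites). PROVED, fact-free, definition-free;
nothing of the manuscript under adjudication is used. Companion of `…Prop44Invariants.lean` (p615828), which carries the other input
invariants (integral, Noetherian, regular, quasi-excellent, `ord ≤ μ`, codimension `≥ 2`) along the same sequences.]

THE POINT. Blowing up a locally Noetherian scheme does not raise the dimension (Matsumura Thm. 15.5 in the form
`IsBlowup.topologicalKrullDim_le_of_isLocallyNoetherian`, `Literature/…/BlowupReducedDimension.lean` — no integrality needed, so no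
bookkeeping of «the centre is a proper closed subset» is required here), and blowing ups of locally Noetherian schemes are locally
Noetherian (`IsBlowup.isLocallyNoetherian`); induction along the two inductive sequence predicates:

* `CampaignW46.IsPermissibleBlowupSeq.isLocallyNoetherian_and_topologicalKrullDim_le` /
  `CampaignW46.IsPermissibleBlowupSeq.topologicalKrullDim_le` — **a W4.6 sequence of permissible blowing-ups `Φ : X₁ → X` over a
  locally Noetherian `X` does not raise `topologicalKrullDim`: `dim X ≤ n ⟹ dim X₁ ≤ n`** (no regularity, integrality or order
  hypothesis);
* `CP2008Prop44.topologicalKrullDim_stage_le` — the same along a Cossart–Piltant sequence `ρ : X → S` (`IsRegularCentreBlowupSeq ρ I`)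
  over a locally Noetherian `S`, WITHOUT the hypotheses `IsIntegral S`, `I ≠ ⊥` of the tree's
  `IsRegularCentreBlowupSeq.topologicalKrullDim_le` (RegularCentreBlowupSeqIntegral.lean), which keeps the stages integral — the
  dimension count does not need them;
* `CP2008Prop44.prop44Invariants_stage_dim` — in the binders of `CossartPiltant2008_prop44` / `prop44Invariants_stage`: for a stage
  `ρ : X → S` over `S` of dimension `≤ n` and every W4.6 sequence `Φ : X₁ → X`, `topologicalKrullDim X₁ ≤ n`; with `n = 3` this is the
  `hX3` rider of `stub_reach` / `stub_curve` (the pattern of `PrincipalizationStages.lean`, `hdimX`, continued through the REACH phase).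

`CossartPiltant2008_prop44` itself is NOT proved; resolution in dimension `≥ 4` / positive characteristic is NOT proved. AI-written; AI review
is weaker than expert review.

## References
* H. Matsumura, *Commutative Ring Theory* (1986), Thm. 15.5 (dimension of the local rings of a blowing up). [Matsumura1987]
* V. Cossart, O. Piltant, *Resolution of singularities of threefolds in positive characteristic I*, J. Algebra 320 (2008), proof of
  Prop. 4.2 (the stages `X(i)` over a threefold are at most three-dimensional), Prop. 4.4. [CossartPiltant2008]
* The Stacks Project, Tag 02NS (blowing up is proper, hence locally of finite type: stages stay locally Noetherian). [StacksProject]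
-/

-- `Summit.<Summit>.<Sub>.Theorems` with `Sub = Summit` (single-conjunct summit, D-0017)
set_option linter.dupNamespace false

noncomputable section

open CategoryTheory AlgebraicGeometry TopologicalSpace IsLocalRing
open Literature.AlgebraicGeometry.Resolution Scheme.IdealSheafData

namespace Summit.ResolutionOfSingularities.ResolutionOfSingularities.Theorems

universe u

namespace CampaignW46

namespace IsPermissibleBlowupSeq

variable {Z : Scheme.{u}} {J : Z.IdealSheafData} {b : ℕ}

/-- **Every stage of a W4.6 sequence of permissible blowing-ups over a locally Noetherian scheme of dimension `≤ n` is locally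
Noetherian of dimension `≤ n`** (induction along the sequence: a blowing up of a locally Noetherian scheme is locally Noetherian,
`IsBlowup.isLocallyNoetherian`, and does not raise the dimension, `IsBlowup.topologicalKrullDim_le_of_isLocallyNoetherian`).
[cite: Matsumura1987, Thm. 15.5] [cite: StacksProject, Tag 02NS] -/
theorem isLocallyNoetherian_and_topologicalKrullDim_le :
    ∀ {Z' : Scheme.{u}} {σ : Z' ⟶ Z} {J' : Z'.IdealSheafData}, IsPermissibleBlowupSeq J b σ J' →
      IsLocallyNoetherian Z → ∀ {n : ℕ}, topologicalKrullDim Z ≤ n →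
        IsLocallyNoetherian Z' ∧ topologicalKrullDim Z' ≤ n := by
  intro Z' σ J' h hN n hdim
  induction h with
  | nil => exact ⟨hN, hdim⟩
  | blowup h D π hreg hD hπ ih =>
    obtain ⟨hN', hdim'⟩ := ih
    haveI := hN'
    exact ⟨hπ.isLocallyNoetherian, hπ.topologicalKrullDim_le_of_isLocallyNoetherian hdim'⟩

/-- **A W4.6 sequence of permissible blowing-ups does not raise `topologicalKrullDim`**: for `Φ : X₁ → X` with
`CampaignW46.IsPermissibleBlowupSeq J b Φ J₁` over a locally Noetherian `X`, `topologicalKrullDim X ≤ n ⟹ topologicalKrullDim X₁ ≤ n`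
(no regularity, integrality, or order hypothesis is needed for the dimension count). [cite: Matsumura1987, Thm. 15.5] -/
theorem topologicalKrullDim_le {Z' : Scheme.{u}} {σ : Z' ⟶ Z} {J' : Z'.IdealSheafData} (h : IsPermissibleBlowupSeq J b σ J')
    (hN : IsLocallyNoetherian Z) {n : ℕ} (hdim : topologicalKrullDim Z ≤ n) : topologicalKrullDim Z' ≤ n :=
  (h.isLocallyNoetherian_and_topologicalKrullDim_le hN hdim).2

end IsPermissibleBlowupSeq

end CampaignW46

namespace CP2008Prop44

/-- **The stages of a Cossart–Piltant sequence over a locally Noetherian scheme of dimension `≤ n` are locally Noetherian of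
dimension `≤ n`** — the tree's `IsRegularCentreBlowupSeq.topologicalKrullDim_le` (RegularCentreBlowupSeqIntegral.lean) without its
hypotheses `IsIntegral S`, `I ≠ ⊥` (there used to keep the stages integral): the dimension count only needs
`IsBlowup.topologicalKrullDim_le_of_isLocallyNoetherian` stage by stage. [cite: Matsumura1987, Thm. 15.5] [cite: StacksProject, Tag 02NS] -/
theorem isLocallyNoetherian_and_topologicalKrullDim_stage_le :
    ∀ {X S : Scheme.{u}} {ρ : X ⟶ S} {I : S.IdealSheafData}, IsRegularCentreBlowupSeq ρ I →
      IsLocallyNoetherian S → ∀ {n : ℕ}, topologicalKrullDim S ≤ n →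
        IsLocallyNoetherian X ∧ topologicalKrullDim X ≤ n := by
  intro X S ρ I h
  induction h with
  | nil J => exact fun hN _ hdim => ⟨hN, hdim⟩
  | @cons S'' S' S τ σ J Y hσ hYint hYreg hY hτ ih =>
    intro hN n hdim
    obtain ⟨hN', hdim'⟩ := ih hN hdim
    haveI := hN'
    exact ⟨hτ.isLocallyNoetherian, hτ.topologicalKrullDim_le_of_isLocallyNoetherian hdim'⟩

/-- **The stages of a Cossart–Piltant sequence do not exceed the dimension of the base**: `IsRegularCentreBlowupSeq ρ I` with
`ρ : X → S`, `S` locally Noetherian, `topologicalKrullDim S ≤ n ⟹ topologicalKrullDim X ≤ n` (any `I`, `S` not assumed integral).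
[cite: Matsumura1987, Thm. 15.5] -/
theorem topologicalKrullDim_stage_le {X S : Scheme.{u}} {ρ : X ⟶ S} {I : S.IdealSheafData} (hρ : IsRegularCentreBlowupSeq ρ I)
    (hN : IsLocallyNoetherian S) {n : ℕ} (hdim : topologicalKrullDim S ≤ n) : topologicalKrullDim X ≤ n :=
  (isLocallyNoetherian_and_topologicalKrullDim_stage_le hρ hN hdim).2

/-- **The dimension pin on the stages of the F-71 assembly (the `hX3` rider).** In the binders of `CossartPiltant2008_prop44` /
`prop44Invariants_stage`: `S` locally Noetherian of dimension `≤ n`, `ρ : X → S` a stage of a Cossart–Piltant sequence for `I`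
(`IsRegularCentreBlowupSeq ρ I`), and `Φ : X₁ → X` any W4.6 sequence of permissible blowing-ups for an idealistic exponent `(J, μ)` on
`X`; then `topologicalKrullDim X₁ ≤ n`. With `n = 3` (`topologicalKrullDim S = 3` in F-71) this is the hypothesis
`(hX3 : topologicalKrullDim X ≤ 3)` of the REACH / curve stubs at every stage reached — the step `hdimX` of
`PrincipalizationStages.lean` continued through the REACH phase. [cite: CossartPiltant2008, Prop. 4.4 (proof, p. 7: the `X(i)` are
threefolds)] [cite: Matsumura1987, Thm. 15.5] -/
theorem prop44Invariants_stage_dim {S : Scheme.{u}} [IsLocallyNoetherian S] {I : S.IdealSheafData} {X : Scheme.{u}} {ρ : X ⟶ S}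
    (hρ : IsRegularCentreBlowupSeq ρ I) {n : ℕ} (hdim : topologicalKrullDim S ≤ n) {J : X.IdealSheafData} {μ : ℕ}
    {X₁ : Scheme.{u}} {Φ : X₁ ⟶ X} {J₁ : X₁.IdealSheafData} (hseq : CampaignW46.IsPermissibleBlowupSeq J μ Φ J₁) :
    topologicalKrullDim X₁ ≤ n := by
  obtain ⟨hN, hdimX⟩ := isLocallyNoetherian_and_topologicalKrullDim_stage_le hρ inferInstance hdim
  exact hseq.topologicalKrullDim_le hN hdimX

end CP2008Prop44

end Summit.ResolutionOfSingularities.ResolutionOfSingularities.Theorems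

end
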